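import Literature.MathematicalPhysics.QuantumLattice.HubbardFermiSeaTangentRowsDiluteFarPlanes
import Summits.Ventures.CertifiedManyBodySolver.Certificates.HubbardTTPrime_polarizedBandCaps_kernelC
import Summits.Ventures.CertifiedManyBodySolver.Observables.PhaseSeparationExclusionBox
import Summits.Ventures.CertifiedManyBodySolver.Observables.PhaseSeparationExclusionBoxThermalDoccAnchor
import Summits.Ventures.CertifiedManyBodySolver.Observables.PhaseSeparationExclusionBoxThermalFreeDilute
import Summits.Ventures.CertifiedManyBodySolver.Observables.PhaseSeparationExclusionFarPlanesStrip
import Summits.Ventures.CertifiedManyBodySolver.Observables.PhaseSeparationExclusionMidSegmentCapWeakCouplingColumns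
import Summits.Ventures.CertifiedManyBodySolver.Observables.PhaseSeparationExclusionNearStripElectronSideColumns
import Summits.Ventures.CertifiedManyBodySolver.Observables.PhaseSeparationExclusionNearStripThermalDE
import Summits.Ventures.CertifiedManyBodySolver.Observables.PhaseSeparationExclusionTPrimeStripEXT5
import Summits.Ventures.CertifiedManyBodySolver.Observables.PhaseSeparationExclusionWitnessSplitCap597
import HarnessLib
import HarnessLib.Audit

/-!
# Ventures/CertifiedManyBodySolver — Observables/PhaseSeparationExclusionNearStripESThermalMottDP2E.lean: `(≤ 9/20 | ≥ 1)` AT `T > 0` on the La-214 strip segment `t′ ∈ [−3/10, −1/4]` (La₂₋ₓSrₓCuO₄ family La214E ×10, cuprate box CB1) — MOTT-ANCHORED edition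

ELECTRON-SIDE-ROW edition (hubbard-downfold-unc-2 g33, generator `gen-g33/yb/gen33.py` over the g31/g32 generators): on the strip segments the `n = 1` COLUMNS are hubbard-box-eng-2's hole-strip floors `es_n1_col6_d30` (B54, `−0.7010542702`), `es_n1_col8_d30` (B67c, `−0.5566907601`), `es_n1_col10_d30` (B85c, `−0.4586829116`) and their `U`-chords `es_n1_law{59o10,15o2,17o2}_d30` (`Observables/PhaseSeparationExclusionNearStripElectronSideColumns.lean`; producer rows hubbard-algo B54/B67c/B85c = K8cL⁺ TL `e₀` LOWER at `(6∣8∣10, 1, +3/10)`, algo-ref CELL-SIDE PASS, BY VALUE as the literal 10-dp hypotheses `hB54`/`hB67c`/`hB85c`; hole strip by particle–hole evenness + `t′`-monotonicity at `n = 1`, `Certificates/HubbardSquare_n1_electronSideRow_holeStripFloor{,_B85}.lean` p740400/p743864), chain `U ∈ {59/10, 6, 8, 10, 12, 16}`; theorem names `es…_`.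
HONEST FRAMING: first certified bounds; not a superconductivity verdict. CLASS = DERIVED / CONTEXT (competing-order word, CONTROL class: the excluded partner phase
has hole doping `≥ 11/20`). `T > 0` twins (canonical sector-Gibbs torus limits, `∀ β ≥ β₀`) of the hole-side `(≤ 9/20 | ≥ 1)` ground-state words, exactly as the a-priori
edition of this seat (g29–g31: `Observables/PhaseSeparationExclusion{NearStrip,FarPol}Thermal*`: SAME caps, SAME `n = 1` column laws BY NAME, SAME dilute floors and kernel
free-gas dilute anchor `β* = 4`), with ONE change: the DENSE partner's hot anchor is no longer the a-priori `p(0; ·; 1) = 2 log 2` but the LOCAL-MOMENT (Mott) entropy ceiling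
`s̄ ≤ log(2 + 2q) − (1 − 2D)·log q` of `Literature/…/HubbardTTPrimeThermalPressureLocalMomentCeiling.lean` (this seat g32: Klein on ONE site with the witness `−κ(n_↑ − n_↓)²`,
box subadditivity, pressure attainment by canonical torus limits), the thermal double occupancy `D` of the dense phase being capped WITHOUT any thermal input by the `U`-chord
against a LAGGED `T = 0` floor `G_i` at `U_i − Δ` (`Δ·D ≤ e_U − G`): law `psT_not_thermal_mix_on_cell_of_columns_doccAnchor_tcap` / `…above_column_doccAnchor_tcap`
(`Observables/PhaseSeparationExclusionBoxThermalDoccAnchor.lean`, g32). The lagged floors are the SAME family of landed `n = 1` column laws one column to the left (exact, carried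
up by Griffiths monotonicity, or `U`-chorded between two columns; each weakened to `≤` the cell's column law), so the premises of each theorem are those of the a-priori edition
plus the lagged laws' own producer anchors BY VALUE / registry nodes BY NAME, verbatim. `q ∈ {2,3,4,5,9,15}` so that only Mathlib's `log 2 / log 3 / log 5` enclosures enter
(`doccWitness_q*`). `β₀ = max(β*, ⌈C₁⌉, ⌈K/M⌉)` per cell from the exact column data printed in each docstring (generator asserts `K < β₀·M` in exact rationals at the four
(column, `s`-end) corners; the kernel re-checks by `nlinarith`). ONLY cells whose threshold improves by ≥ 0 over the a-priori edition are re-issued here.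

THIS FILE (cells; `β·t ≥ β₀` ⇔ `T ≤ t/(k_B β₀)`): `[16,100]` β ≥ 15 (was 22; POL_pol5o8_m30m20, q=15).
WHY: the a-priori `2 log 2` was ≥ 80 % of every threshold numerator; at half filling the interaction freezes the charge entropy, and the tree's own `n = 1` floors one column
to the left certify how much (chord slope `(L_i − G_i)/Δ ≈ 0.00–0.07` for `U ≥ 7`): thresholds drop 20–45 % on the cells binding the routed `(2/5∣1)` / `(9/20∣1)` `T`-axis words.
WHAT THIS IS NOT: a certificate or number of record; CONTROL-class words conditional BY NAME / BY VALUE on the premises printed in each signature; canonical sector-Gibbs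
torus limits (existence not claimed); nothing about stripes as states, ferromagnetism, superconductivity or `T_c`.

Seat hubbard-downfold-unc-2 g32 (`prover-hubbard-downfold-unc-2-g32-0`); generator `pub/hubbard-downfold/hubbard-downfold-unc-2/gen-g32/yb/gen32_cells.py` (exact `fractions`;
cap / column-law tables = gen31_cells.py's, imported read-only from hubbard-box-p3's `work-g33/far1/emit_far1.py` and `work-g34/ws597/{cells597,emit597}.py`).
[cite: Israel1979, Thm. I.2.4] [cite: EmeryKivelsonLin1990, pp. 475–476] [cite: PoulinHastings2011, eqs. (3)–(8)] [cite: Griffiths1966, §II] [cite: Ruelle1969, §3.4] [cite: Lieb1973, §V (5.2)–(5.4)] [cite: BachLiebSolovej1994, eq. (2c.36)] [cite: LiebLoss1993, §8, Theorem 8.2]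
-/

noncomputable section

namespace Summit.Ventures.CertifiedManyBodySolver.Observables

open Summit.Ventures.CertifiedManyBodySolver.Certificates Summit.Ventures.CertifiedManyBodySolver.Downfold
open Literature.MathematicalPhysics.QuantumLattice Literature.MathematicalPhysics.QuantumLattice.ThermodynamicLimit
open Literature.MathematicalPhysics.QuantumLattice.InfVolFermionState Set Filter

/-! ## `(≤ 9/20 | ≥ 1)` at `T > 0` (Mott anchor), segment D: `t′ ∈ [-3 / 10, -1 / 4]` -/

/-- **`(≤ 9/20 | ≥ 1)` at `T > 0`, MOTT-ANCHORED — segment D `t′ ∈ [-3 / 10, -1 / 4]`, ABOVE the column `U = 16` up to `U = 100`, EVERY `β ≥ 15`**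
(`T ≲ 232–387 K` for `t ∈ [0.30, 0.50] eV`; a-priori edition (g31): β ≥ 22 (POL_pol5o8_m30m20)). Witness filling `5 / 8` (`a, b = 15 / 22, 7 / 22`); cap = the PROVED kernel FULLY-POLARISED band cap `pol5o8_m30m20` (one spin species at density `5 / 8`, `U`-independent; no claim node); the Griffiths-monotone `n = 1` column law
`fp_n1_col16_m30m25` at `U = 16` floors every larger `U`; DENSE ANCHOR = local-moment entropy with `q = 15` (`C₀ = 0.7576857`, `C₁ ≤ 0.7737`), lagged column = the law `es_n1_law9_d30` at `U = 9`
(chord slope `(L − G)/(U₂ − U_l)` at `s = -3 / 10 ∣ -1 / 4`: 0.0207∣0.0223); dilute rows / free-gas anchor `free4_9o20_tpm3o10_tpm1o4` as in the column pieces; law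
`psT_not_thermal_mix_above_column_doccAnchor_tcap`. Far-end data: `U = 100` end (cap slope `c₁ = 0.00000` ≥ 0): M 0.0629∣0.0261, K/M 6.45∣14.93. [cite: Israel1979, Thm. I.2.4] [cite: EmeryKivelsonLin1990, pp. 475–476] [cite: PoulinHastings2011, eqs. (3)–(8)] [cite: Griffiths1966, §II] [cite: Ruelle1969, §3.4] [cite: Lieb1973, §V (5.2)–(5.4)] -/
theorem esTm_9o20_D_above16to100_beta15 (hX16m30 : ((-453707447/1250000000 : ℚ) : ℝ) ≤ energyDensityTT' 1 (-3 / 10) 16 1) (hX16m25 : ((-3516799493/10000000000 : ℚ) : ℝ) ≤ energyDensityTT' 1 (-1 / 4) 16 1) (hB67c : ((-5566907601/10000000000 : ℚ) : ℝ) ≤ energyDensityTT' 1 (3 / 10) 8 1) (hB85c : ((-1146707279/2500000000 : ℚ) : ℝ) ≤ energyDensityTT' 1 (3 / 10) 10 1)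
    {s : ℝ} (hs : s ∈ Icc (-3 / 10 : ℝ) (-1 / 4)) {U : ℝ} (hU : U ∈ Icc (16 : ℝ) (100))
    {β : ℝ} (hβ : (15 : ℝ) ≤ β)
    {ω₁ ω₂ : InfVolFermionState 2} (h₁ : ω₁.IsTranslationInvariant) (h₂ : ω₂.IsTranslationInvariant)
    (hρ₁ : 0 < ω₁.density) (hρ₁' : ω₁.density ≤ 9 / 20) (hρ₂ : 1 ≤ ω₂.density) (hρ₂' : ω₂.density < 2)
    {n : ℝ} (hn0 : 0 < n) (hn2 : n < 2) {lam : ℝ} (hl0 : 0 < lam) (hl1 : lam < 1) {Ls : ℕ → ℕ}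
    (hLs : Tendsto Ls atTop atTop) :
    ¬ (mix lam hl0.le hl1.le ω₁ ω₂).IsTorusLimitOfMixture (sectorGibbsCount n) (fun L => sectorGibbsWeightTT' β 1 s U n L)
      (fun L => sectorGibbsVectorTT' 1 s U n L) Ls := by
  refine psT_not_thermal_mix_above_column_doccAnchor_tcap 1 (s₁ := -3 / 10) (s₂ := -1 / 4) (U₂ := 16) (U₃ := 100) (Ul := 9)
    (n₁ := 9 / 20) (n₂ := 1) (a := 15 / 22) (b := 7 / 22) (β₀ := 15) (βh₁ := 4) (βh₂ := 13540251007 / 17500000000) (q := 15) (C₀ := 947107129 / 1250000000) (C₁ := 13540251007 / 17500000000)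
    (c₀ := ((-96831/125000 : ℚ) : ℝ)) (cs := ((1497109/5000000 : ℚ) : ℝ)) (c₁ := ((0 : ℚ) : ℝ))
    (L := fun s => ((-1476249539/5000000000 : ℚ) : ℝ) + ((112860083/500000000 : ℚ) : ℝ) * s) (G := fun s => ((-10153736717/20000000000 : ℚ) : ℝ) + ((0 : ℚ) : ℝ) * s)
    (by norm_num) (by norm_num) (by norm_num) (by norm_num) (by norm_num) (by norm_num) (by norm_num) (by norm_num) (by norm_num) (by norm_num) (by norm_num) (by norm_num)
    (by obtain ⟨hA, hlo, hhi⟩ := doccWitness_q15; norm_num at hA hlo hhi ⊢; linarith)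
    (by obtain ⟨hA, hlo, hhi⟩ := doccWitness_q15; norm_num at hA hlo hhi ⊢; nlinarith [hhi, Real.log_nonneg (show (1:ℝ) ≤ 15 by norm_num)])
    (by norm_num) (by norm_num) hβ (by norm_num)
    (pol5o8_m30m20_tcap_on_cell (by norm_num) (by norm_num) (by norm_num) (by norm_num))
    (fun s hs => by obtain ⟨h1, h2⟩ := hs; have h := fp_n1_col16_m30m25 hX16m30 hX16m25 s ⟨h1.trans' (by norm_num), h2.trans (by norm_num)⟩; push_cast at h ⊢; nlinarith [h, h1, h2])
    (fun s hs => by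
      obtain ⟨h1, h2⟩ := hs; have h := es_n1_law9_d30 hB67c hB85c s ⟨h1.trans' (by norm_num), h2.trans (by norm_num)⟩
      rw [show (9 : ℝ) = 9 by norm_num]; push_cast at h ⊢; nlinarith [h, h1, h2])
    ?_
    (fun s hs U hU => floor_on_cell_of_tPrime_end_rows 1 (n := 9 / 20) (by norm_num) (by norm_num) (by norm_num)
      (fun _ hU' => fermiSeaTangentRow_tPrime_neg_three_div_ten_at_nine_div_twenty hU' (by norm_num) (by norm_num)) (fun _ hU' => fermiSeaTangentRow_tPrime_neg_one_div_four_at_nine_div_twenty hU' (by norm_num) (by norm_num)) s ⟨hs.1.trans' (by norm_num), hs.2.trans (by norm_num)⟩ U (by linarith [hU.1]))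
    (free4_9o20_tpm3o10_tpm1o4 (by norm_num) (by norm_num) (by norm_num))
    ?_ ?_ hs hU h₁ h₂ hρ₁ hρ₁' hρ₂ hρ₂' hn0 hn2 hl0 hl1 hLs
  · intro s hs; obtain ⟨h1, h2⟩ := hs; push_cast; nlinarith [h1, h2]
  · intro s hs; obtain ⟨h1, h2⟩ := hs; push_cast; norm_num; nlinarith [h1, h2]
  · intro s hs; obtain ⟨h1, h2⟩ := hs; push_cast; norm_num; nlinarith [h1, h2]

end Summit.Ventures.CertifiedManyBodySolver.Observables

end
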